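import Summits.AnomalousDissipation.AnomalousDissipation.Theorems.SteadyMirrorGateMirrorSteadyExistenceTGGalerkin


/-!
# Routes SteadyMirrorGate / PumpSignGate (AnomalousDissipation) — support `MirrorSteadyExistenceTG`
# (stmt-AnomalousDissipation-28078, Ex «MIRROR STEADY EXISTENCE»): K-symmetric steady states of
# `NS_ν(f_TG)` exist at every viscosity

Settles the shared support item stmt-AnomalousDissipation-28078 (`SteadyMirrorGate.MirrorSteadyExistenceTG`,
`PumpSignGate.MirrorSteadyExistenceTG`; rank 9, «theorem-grade, attackable now»): at the pinned Taylor–Green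
force `f_TG = (sin 2πx cos 2πy cos 2πz, −cos 2πx sin 2πy cos 2πz, 0)` and every `ν > 0` there is a steady
weak solution `u ∈ V` of the forced Navier–Stokes equations which satisfies the energy equality
`ν ‖∇u‖² = (u, f_TG)` and lies in the a.e. mirror class `Fix K`
(`(u ∘ σ_i)_j = (R_i u)_j` a.e., `σ_i` the reflection of the `i`-th coordinate of `T³`, `R_i` the sign flip
of the `i`-th component, all `i, j`).

## Proof (Temam 1979, Ch. II §1, Thm. 1.2, run inside the closed `K`-invariant subspace)

Written for any dimension `d`, any smooth force `f` and any finite list `G` of affine lattice symmetries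
`A y = (ε_j y_{σ j} + b_j)_j` (`σ` a coordinate permutation, `ε_j = ±1`, `b ∈ T^d`) acting on values by
`(Qv)_i = ε_i v_{σ i}` under which `f` is covariant (`f ∘ A = Q ∘ f`); the mirror group `K` of `T³` is the
list of the three coordinate reflections `(1, ε^{(i)}, 0)`, `ε^{(i)}_j = −1` iff `j = i`.

1. **Fourier side of the symmetries** (§1, the tree's `EnsembleRigidity.GPMeanBoundedFamily.StubSymmetricScheme`
   toolkit, re-proved verbatim here because that `Theorems` module is not importable from this one): covariance
   `u ∘ A = Q ∘ u` of a continuous field is equivalent to the twisted relation `û(Qk) = e_{−Qk}(b) Q û(k)` on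
   Fourier coefficients (`mFourierCoeff_of_symmetric`, `symmetric_of_mFourierCoeff`), and the Fourier–Galerkin
   vector field preserves the twisted relation (`galerkinField_signedPerm`).
2. **Stationary Galerkin solutions in an invariant subspace** (§2): the acute-angle (Brouwer) argument of the
   tree's `exists_galerkinRHS_eq_zero` (Temam (1.25)–(1.30), Lemma 1.4) runs verbatim in any subspace `W` of the
   Galerkin phase space mapped into itself by the Galerkin field (`exists_galerkinRHS_eq_zero_of_invariant`):
   the coercivity `[−V(c), c] = ν‖∇u‖² − ⟨f, u⟩ ≥ 0` on large spheres is inherited.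
3. **The symmetric stationary Galerkin sequence** (§3): with `W_N = galerkinSubspace S_N ⊓ {twisted relation}`
   on the punctured balls `S_N = {0 < |k|² ≤ N²}` (stable under every `Q`), the zeros give smooth divergence-free
   mean-zero `G`-covariant fields `U_N` with Temam's a priori bounds solving the tested Galerkin equations
   (`exists_symmetric_steady_galerkin_sequence`; the derivations are the tree's `exists_steady_galerkin_approx`).
4. **Passage to the limit** (§4, the tree's `exists_mem_energySpaceV_isSteadyWeakSolution` verbatim): the
   enstrophy ball is compact in `H` (Rellich), a subsequence converges in `H` to a steady weak solution `u ∈ V`;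
   the a.e. covariance class is closed in `H` (`isClosed_symmClass`: an `L²`-convergent sequence converges a.e.
   along a subsequence, also along the measure-preserving map `A`), so `u` is covariant a.e.
   (`exists_symmetric_steadyWeakSolution`).
5. **Taylor–Green** (§5): `f_TG` is smooth, divergence free, mean zero (tree: `isSmooth_tgForce`,
   `hasZeroMean_tgForce`) and `K`-covariant (parity of `cos`, `sin`); the energy equality holds for every steady
   weak solution in `V` in dimension `≤ 4` (tree: `Torus.IsSteadyWeakSolution.energy_eq'`).
   Main results: `steadyMirrorGate_mirrorSteadyExistenceTG_holds`, `pumpSignGate_mirrorSteadyExistenceTG_holds`.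

References: Temam 1979, Ch. II §1, Thm. 1.2 + Lemma 1.4 [Temam1979]; Constantin–Foias 1988, Ch. 8 (8.3)–(8.7)
[ConstantinFoias1988]; Foias–Manley–Rosa–Temam 2001, Ch. II §7 (steady states) [FMRTTurbulence2001];
Galdi 2011, Ch. IX (symmetric steady solutions by invariant Galerkin bases) [Galdi2000].

TREE LANDING NOTE (decomp-ad census g17, prover-role seat): the lens-6 g57 landable K4 (sha256 a3cdef44b87d854d…, 891 l.) was
BOUNCED by the gate lint `statement-form` (Theorems files with proofs ≤ 400 lines) and is landed SPLIT BY TOPIC into three modules with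
every declaration byte-identical: `SteadyMirrorGateMirrorSteadyExistenceTGSymmetry` (§1 signed permutations / affine symmetries, §2 stationary
Galerkin solutions in an invariant subspace), `SteadyMirrorGateMirrorSteadyExistenceTGGalerkin` (§3 the symmetric stationary Galerkin sequence;
imports the first) and this closer (§4 passage to the limit, §5 the mirror group and `f_TG`, the two route decls; imports the second).
-/

noncomputable section

-- every `Summit.AnomalousDissipation.AnomalousDissipation.…` name repeats the summit = sub-problem segment (D-0017 layout)
set_option linter.dupNamespace false

namespace Summit.AnomalousDissipation.AnomalousDissipation.Theorems

open MeasureTheory Filter Topology Set UnitAddTorus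
open scoped ENNReal NNReal InnerProductSpace
open Literature.Analysis.FunctionSpaces Literature.Analysis.FluidPDE

namespace MirrorSteadyExistence

-- §1 symmetry engine shared with the tree module `EnsembleRigidityGPMeanBoundedFamilyStubSymmetricScheme` (census g17 dedup, see part 1)
open Summit.AnomalousDissipation.AnomalousDissipation.Theorems.EnsembleRigidity.GPMeanBoundedFamily.StubSymmetricScheme

/-! ## §4 Passage to the limit inside the closed covariance class (Temam 1979, Ch. II §1, Thm. 1.2 (iii)) -/

section Limit

open Literature.Analysis.FunctionSpaces.Torus Literature.Analysis.FluidPDE.Torus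

/-- **The a.e. covariance class of an affine lattice symmetry is closed in `H`**: the set of `u ∈ H` with
`u (A y) i = ε_i u y (σ i)` for a.e. `y` is sequentially closed — an `H`-convergent sequence converges in
`L²`, hence a.e. along a subsequence, and also a.e. along the measure-preserving map `A`
(`measurePreserving_affine`), so the pointwise identities pass to the limit. [folklore] -/
theorem isClosed_symmClass {d : Type*} [Fintype d] [DecidableEq d] (σ : Equiv.Perm d) {ε : d → ℤ}
    (hε : ∀ j, ε j = 1 ∨ ε j = -1) (b : UnitAddTorus d) (i : d) :
    IsClosed {u : energySpace d |
      (fun y => (u.1 : UnitAddTorus d → EuclideanSpace ℝ d) (fun j => ε j • y (σ j) + b j) i)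
        =ᵐ[volume] fun y => (ε i : ℝ) * (u.1 : UnitAddTorus d → EuclideanSpace ℝ d) y (σ i)} := by
  refine IsSeqClosed.isClosed ?_
  have hA : MeasurePreserving (fun y : UnitAddTorus d => fun j => ε j • y (σ j) + b j) volume volume :=
    measurePreserving_affine σ hε b
  intro U u hU hUu
  simp only [Set.mem_setOf_eq] at hU ⊢
  -- `U n → u` in `H`, hence in `L²`, hence a subsequence converges almost everywhere
  have h1 : Tendsto (fun n => ((U n).1 : Lp (EuclideanSpace ℝ d) 2
      (volume : Measure (UnitAddTorus d)))) atTop (𝓝 u.1) :=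
    (continuous_subtype_val.tendsto u).comp hUu
  obtain ⟨ns, -, hae⟩ := (tendstoInMeasure_of_tendsto_Lp h1).exists_seq_tendsto_ae
  -- … and also almost everywhere along the measure-preserving map `A`
  have hae' : ∀ᵐ y ∂(volume : Measure (UnitAddTorus d)),
      Tendsto (fun k => ((U (ns k)).1 : UnitAddTorus d → EuclideanSpace ℝ d)
        (fun j => ε j • y (σ j) + b j)) atTop
        (𝓝 ((u.1 : UnitAddTorus d → EuclideanSpace ℝ d) (fun j => ε j • y (σ j) + b j))) :=
    hA.quasiMeasurePreserving.ae hae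
  have hmem : ∀ᵐ y ∂(volume : Measure (UnitAddTorus d)), ∀ k,
      ((U (ns k)).1 : UnitAddTorus d → EuclideanSpace ℝ d) (fun j => ε j • y (σ j) + b j) i =
        (ε i : ℝ) * ((U (ns k)).1 : UnitAddTorus d → EuclideanSpace ℝ d) y (σ i) :=
    ae_all_iff.2 fun k => hU (ns k)
  have hproj : ∀ j : d, Continuous fun v : EuclideanSpace ℝ d => v j := fun j =>
    (EuclideanSpace.proj j).continuous
  filter_upwards [hae, hae', hmem] with y hy hy' hym
  -- pass to the limit in the pointwise identities along the subsequence
  have h2 : Tendsto (fun k => (ε i : ℝ) * ((U (ns k)).1 : UnitAddTorus d → EuclideanSpace ℝ d) y (σ i))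
      atTop (𝓝 ((ε i : ℝ) * (u.1 : UnitAddTorus d → EuclideanSpace ℝ d) y (σ i))) :=
    (((hproj (σ i)).tendsto _).comp hy).const_mul _
  exact tendsto_nhds_unique (((hproj i).tendsto _).comp hy') (h2.congr fun k => (hym k).symm)

/-- **Existence of symmetric steady weak solutions of the forced Navier–Stokes equations on `T^d`, every
viscosity** (Temam 1979, Ch. II §1, Thm. 1.2, run in a symmetry class): for `ν > 0`, a smooth force `f`
covariant under a finite list `G` of affine lattice symmetries `A y = (ε_j y_{σ j} + b_j)_j` (values acted on
by `(Qv)_i = ε_i v_{σ i}`), there is a steady weak solution `u ∈ V` covariant a.e. under every `A ∈ G`.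
Proof: the symmetric Galerkin sequence of `exists_symmetric_steady_galerkin_sequence` lies in a compact
enstrophy ball of `H` (`Torus.isCompact_setOf_eGradNormSq_le`) and in the closed covariance classes
(`isClosed_symmClass`); a limit point is a steady weak solution exactly as in the tree's
`exists_mem_energySpaceV_isSteadyWeakSolution` (`tendsto_integral_weakForm_of_tendsto_lintegral`,
`tendsto_integral_weakForm_fourierTruncate`) and stays in the classes. [cite: Temam1979, Ch. II Thm. 1.2] -/
theorem exists_symmetric_steadyWeakSolution {d : Type*} [Fintype d] [DecidableEq d] {ν : ℝ} (hν : 0 < ν)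
    (G : List (Equiv.Perm d × (d → ℤ) × UnitAddTorus d))
    (hG : ∀ p ∈ G, ∀ j, p.2.1 j = 1 ∨ p.2.1 j = -1) {f : UnitAddTorus d → EuclideanSpace ℝ d}
    (hf : IsSmooth f) (hfG : ∀ p ∈ G, ∀ (y : UnitAddTorus d) (i : d),
      f (fun j => p.2.1 j • y (p.1 j) + p.2.2 j) i = (p.2.1 i : ℝ) * f y (p.1 i)) :
    ∃ u : energySpace d, u.1 ∈ energySpaceV d ∧ IsSteadyWeakSolution ν f u ∧
      ∀ p ∈ G, ∀ i : d,
        (fun y => (u.1 : UnitAddTorus d → EuclideanSpace ℝ d) (fun j => p.2.1 j • y (p.1 j) + p.2.2 j) i)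
          =ᵐ[volume] fun y => (p.2.1 i : ℝ) * (u.1 : UnitAddTorus d → EuclideanSpace ℝ d) y (p.1 i) := by
  have hf2 : MemLp f 2 volume := hf.memLp 2
  obtain ⟨U, hUs, hUdiv, hUmean, hUgrad, hUL2, hUtest, hUsym⟩ :=
    exists_symmetric_steady_galerkin_sequence hν G hG hf hfG
  have hUm : ∀ N, MemLp (U N) 2 volume := fun N => (hUs N).memLp 2
  -- the approximations as elements of `H`
  have hmem : ∀ N, (hUm N).toLp (U N) ∈ energySpace d := fun N =>
    smoothSolenoidal_subset_energySpace ⟨U N, hUs N, hUdiv N, hUmean N, (hUm N).coeFn_toLp⟩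
  set v : ℕ → energySpace d := fun N => ⟨(hUm N).toLp (U N), hmem N⟩ with hv
  have hvae : ∀ N, ((v N).1 : UnitAddTorus d → EuclideanSpace ℝ d) =ᵐ[volume] U N := fun N =>
    (hUm N).coeFn_toLp
  -- the approximations lie in the covariance classes
  have hvC : ∀ N, ∀ p ∈ G, ∀ i : d,
      (fun y => ((v N).1 : UnitAddTorus d → EuclideanSpace ℝ d)
        (fun j => p.2.1 j • y (p.1 j) + p.2.2 j) i) =ᵐ[volume]
        fun y => (p.2.1 i : ℝ) * ((v N).1 : UnitAddTorus d → EuclideanSpace ℝ d) y (p.1 i) := by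
    intro N p hp i
    have hA := measurePreserving_affine p.1 (hG p hp) p.2.2
    have h1 : ∀ᵐ y ∂(volume : Measure (UnitAddTorus d)),
        ((v N).1 : UnitAddTorus d → EuclideanSpace ℝ d) (fun j => p.2.1 j • y (p.1 j) + p.2.2 j) =
          U N (fun j => p.2.1 j • y (p.1 j) + p.2.2 j) :=
      hA.quasiMeasurePreserving.ae_eq_comp (hvae N)
    filter_upwards [h1, hvae N] with y hy hy'
    rw [hy, hUsym N p hp y i, hy']
  -- compactness of the enstrophy ball (Rellich)
  set R : ℝ≥0∞ :=
    ENNReal.ofReal (4 * Real.pi ^ 2 * ((∫ x, ‖f x‖ ^ 2) / (4 * Real.pi ^ 2 * ν) ^ 2)) with hR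
  set K : Set (energySpace d) :=
    {u | eGradNormSq (u.1 : UnitAddTorus d → EuclideanSpace ℝ d) ≤ R} with hK
  have hKc : IsCompact K := isCompact_setOf_eGradNormSq_le ENNReal.ofReal_ne_top
  have hvK : ∀ N, v N ∈ K := fun N => by
    show eGradNormSq ((v N).1 : UnitAddTorus d → EuclideanSpace ℝ d) ≤ R
    rw [eGradNormSq_congr_ae_field (hvae N)]
    exact hUgrad N
  obtain ⟨u, huK, φ, hφ, hlim⟩ := hKc.tendsto_subseq hvK
  have huL2 : MemLp (u.1 : UnitAddTorus d → EuclideanSpace ℝ d) 2 volume := Lp.memLp _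
  have huG : eGradNormSq (u.1 : UnitAddTorus d → EuclideanSpace ℝ d) ≤ R := huK
  -- the limit stays in the closed covariance classes
  have huC : ∀ p ∈ G, ∀ i : d,
      (fun y => (u.1 : UnitAddTorus d → EuclideanSpace ℝ d) (fun j => p.2.1 j • y (p.1 j) + p.2.2 j) i)
        =ᵐ[volume] fun y => (p.2.1 i : ℝ) * (u.1 : UnitAddTorus d → EuclideanSpace ℝ d) y (p.1 i) :=
    fun p hp i => (isClosed_symmClass p.1 (hG p hp) p.2.2 i).mem_of_tendsto hlim
      (Eventually.of_forall fun j => hvC (φ j) p hp i)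
  refine ⟨u, ⟨u.2, memSobolev_one_complexify_of_eGradNormSq_ne_top huL2
    (ne_top_of_le_ne_top ENNReal.ofReal_ne_top huG)⟩, ?_, huC⟩
  -- strong convergence in `L²` along the subsequence
  have hconv : Tendsto (fun j => ∫⁻ x,
      ‖U (φ j) x - (u.1 : UnitAddTorus d → EuclideanSpace ℝ d) x‖ₑ ^ 2) atTop (𝓝 0) := by
    have h1 : Tendsto (fun j => (v (φ j)).1) atTop (𝓝 u.1) :=
      (continuous_subtype_val.tendsto u).comp hlim
    have h2 := tendsto_iff_norm_sub_tendsto_zero.1 h1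
    have h3 : Tendsto (fun j => ‖(v (φ j)).1 - u.1‖ₑ ^ 2) atTop (𝓝 0) := by
      have h4 := ENNReal.tendsto_ofReal h2
      rw [ENNReal.ofReal_zero] at h4
      have h5 := ((ENNReal.continuous_pow 2).tendsto 0).comp h4
      rw [zero_pow two_ne_zero] at h5
      refine h5.congr fun j => ?_
      simp only [Function.comp_apply, ofReal_norm]
    refine h3.congr fun j => ?_
    rw [← lintegral_enorm_coe_sub_coe_sq]
    refine lintegral_congr_ae ?_
    filter_upwards [hvae (φ j)] with x hx
    rw [hx]
  -- the weak formulation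
  intro w hw hwdiv hwmean
  -- the limit solves the equations against the truncations `P_M w`
  have htrunc : ∀ M : ℕ, ∫ x, (⟪(u.1 : UnitAddTorus d → EuclideanSpace ℝ d) x,
      Literature.Analysis.FunctionSpaces.Torus.convect (u.1 : UnitAddTorus d → EuclideanSpace ℝ d)
        (fourierTruncate M w) x⟫_ℝ +
      ν * ⟪(u.1 : UnitAddTorus d → EuclideanSpace ℝ d) x, laplacian (fourierTruncate M w) x⟫_ℝ +
      ⟪f x, fourierTruncate M w x⟫_ℝ) = 0 := by
    intro M
    have ha : IsSmooth (fourierTruncate M w) := isSmooth_fourierTruncate M w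
    have hadiv : IsDivFree (fourierTruncate M w) :=
      isDivFree_realTrigPoly (hwdiv.isTransversal_mFourierCoeff hw (freqBall M))
    have hw0 : mFourierCoeff (EuclideanSpace.complexify ∘ w) 0 = 0 := by
      rw [mFourierCoeff_eq_integral_volume]
      simp only [neg_zero, mFourier_zero, ContinuousMap.one_apply, one_smul, Function.comp_apply]
      rw [EuclideanSpace.complexify.integral_comp_comm w, hwmean, map_zero]
    have hband : ∀ N, M ≤ N → ∀ k ∉ (freqBall (d := d) N).erase 0,
        mFourierCoeff (EuclideanSpace.complexify ∘ fourierTruncate M w) k = 0 := by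
      intro N hMN k hk
      rw [mFourierCoeff_fourierTruncate hw.integrable]
      by_cases hkM : k ∈ freqBall M
      · have hk0 : k = 0 := by
          by_contra h
          exact hk (Finset.mem_erase.2 ⟨h, freqBall_mono hMN hkM⟩)
        subst hk0
        rw [if_pos hkM, hw0]
      · rw [if_neg hkM]
    have hev : ∀ᶠ j in atTop,
        ∫ x, (⟪U (φ j) x, Literature.Analysis.FunctionSpaces.Torus.convect (U (φ j)) (fourierTruncate M w) x⟫_ℝ +
          ν * ⟪U (φ j) x, laplacian (fourierTruncate M w) x⟫_ℝ +
          ⟪f x, fourierTruncate M w x⟫_ℝ) = 0 := by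
      filter_upwards [eventually_ge_atTop M] with j hj
      exact hUtest (φ j) _ ha hadiv (hband (φ j) (hj.trans (hφ.id_le j)))
    have hl := tendsto_integral_weakForm_of_tendsto_lintegral (ν := ν) hf2 (fun n => hUm (φ n))
      huL2 ENNReal.ofReal_ne_top (fun n => hUL2 (φ n)) hconv ha
    exact tendsto_nhds_unique hl (tendsto_const_nhds.congr' (hev.mono fun j hj => hj.symm))
  -- remove the truncation
  have hl2 := tendsto_integral_weakForm_fourierTruncate ν hf2 huL2 hw
  have hzero : ∫ x, (⟪(u.1 : UnitAddTorus d → EuclideanSpace ℝ d) x,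
      Literature.Analysis.FunctionSpaces.Torus.convect (u.1 : UnitAddTorus d → EuclideanSpace ℝ d) w x⟫_ℝ +
      ν * ⟪(u.1 : UnitAddTorus d → EuclideanSpace ℝ d) x, laplacian w x⟫_ℝ + ⟪f x, w x⟫_ℝ) = 0 :=
    tendsto_nhds_unique hl2 (tendsto_const_nhds.congr fun M => (htrunc M).symm)
  have hfinal : nsGeneratorPairing ν f u w =
      ∫ x, (⟪(u.1 : UnitAddTorus d → EuclideanSpace ℝ d) x,
        Literature.Analysis.FunctionSpaces.Torus.convect (u.1 : UnitAddTorus d → EuclideanSpace ℝ d) w x⟫_ℝ +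
        ν * ⟪(u.1 : UnitAddTorus d → EuclideanSpace ℝ d) x, laplacian w x⟫_ℝ + ⟪f x, w x⟫_ℝ) := by
    rw [integral_weakForm_eq ν hf2 huL2 hw]
    rfl
  rw [hfinal]
  exact hzero

end Limit

/-! ## §5 The mirror group `K` of `T³` and the Taylor–Green force -/

section TaylorGreen

open Literature.Analysis.FunctionSpaces.Torus Literature.Analysis.FluidPDE.Torus
open Summit.AnomalousDissipation.AnomalousDissipation.Theorems.TaylorGreenLoudGalerkinStates.Negative

/-- The value sign of the `i`-th coordinate reflection: `ε^{(i)}_j = −1` iff `j = i`. -/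
def mirrorSign (i j : Fin 3) : ℤ := if j = i then -1 else 1

/-- The mirror group `K`: the three coordinate reflections of `T³` as affine lattice symmetries
`(σ, ε, b) = (1, ε^{(i)}, 0)`. -/
def mirrorList : List (Equiv.Perm (Fin 3) × (Fin 3 → ℤ) × UnitAddTorus (Fin 3)) :=
  (List.finRange 3).map fun i => (Equiv.refl _, mirrorSign i, 0)

/-- `ε^{(i)}_j = ±1`. [folklore] -/
theorem mirrorSign_eq (i j : Fin 3) : mirrorSign i j = 1 ∨ mirrorSign i j = -1 := by
  unfold mirrorSign; split_ifs <;> simp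

/-- The affine map of `(1, ε^{(i)}, 0)` is the coordinate reflection `σ_i y = update y i (−y i)`. [folklore] -/
theorem mirror_affine_eq (i : Fin 3) (y : UnitAddTorus (Fin 3)) :
    (fun j => mirrorSign i j • y ((Equiv.refl (Fin 3)) j) + (0 : UnitAddTorus (Fin 3)) j) =
      Function.update y i (-y i) := by
  funext j
  by_cases h : j = i
  · subst h
    simp [mirrorSign]
  · simp [mirrorSign, h]

/-- The value action of `(1, ε^{(i)}, 0)`: `ε^{(i)}_j w = if j = i then −w else w`. [folklore] -/
theorem mirrorSign_mul (i j : Fin 3) (w : ℝ) :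
    (mirrorSign i j : ℝ) * w = if j = i then -w else w := by
  unfold mirrorSign; split_ifs <;> simp

/-- `e_1(−t) = conj e_1(t)` on the unit circle. [folklore] -/
theorem fourier_one_neg (t : UnitAddCircle) :
    (fourier 1 (-t) : ℂ) = starRingEnd ℂ (fourier 1 t) := by
  rw [← neg_one_zsmul t, fourier_apply (x := (-1 : ℤ) • t), smul_smul, one_mul, ← fourier_apply]
  exact fourier_neg

/-- `Re e_1(−t) = Re e_1(t)` (`cos` is even). [folklore] -/
theorem fourier_one_neg_re (t : UnitAddCircle) : (fourier 1 (-t) : ℂ).re = (fourier 1 t : ℂ).re := by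
  rw [fourier_one_neg, Complex.conj_re]

/-- `Im e_1(−t) = −Im e_1(t)` (`sin` is odd). [folklore] -/
theorem fourier_one_neg_im (t : UnitAddCircle) : (fourier 1 (-t) : ℂ).im = -(fourier 1 t : ℂ).im := by
  rw [fourier_one_neg, Complex.conj_im]

/-- `Re` of the circle point of `−t` equals that of `t` (simp-normal form of `fourier_one_neg_re`). [folklore] -/
theorem toCircle_neg_re (t : UnitAddCircle) :
    ((AddCircle.toCircle (-t) : Circle) : ℂ).re = ((AddCircle.toCircle t : Circle) : ℂ).re := by
  simpa using fourier_one_neg_re t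

/-- `Im` of the circle point of `−t` is minus that of `t` (simp-normal form of `fourier_one_neg_im`). [folklore] -/
theorem toCircle_neg_im (t : UnitAddCircle) :
    ((AddCircle.toCircle (-t) : Circle) : ℂ).im = -((AddCircle.toCircle t : Circle) : ℂ).im := by
  simpa using fourier_one_neg_im t

/-- **`f_TG ∈ Fix K`**: the Taylor–Green force is covariant under the three coordinate reflections,
`f_TG (σ_i y) j = ε^{(i)}_j f_TG y j` (parity of `sin`, `cos`). [cite: TaylorGreen1937] -/
theorem tgForce_mirror (i : Fin 3) (y : UnitAddTorus (Fin 3)) (j : Fin 3) :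
    tgForce (Function.update y i (-y i)) j = (mirrorSign i j : ℝ) * tgForce y j := by
  fin_cases i <;> fin_cases j <;>
    simp [tgForce, mirrorSign, toCircle_neg_re, toCircle_neg_im]

/-- `f_TG` is covariant under every element of the mirror list. [folklore] -/
theorem tgForce_mirrorList : ∀ p ∈ mirrorList, ∀ (y : UnitAddTorus (Fin 3)) (i : Fin 3),
    tgForce (fun j => p.2.1 j • y (p.1 j) + p.2.2 j) i = (p.2.1 i : ℝ) * tgForce y (p.1 i) := by
  intro p hp y j
  obtain ⟨i, -, rfl⟩ := List.mem_map.1 hp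
  show tgForce (fun jj => mirrorSign i jj • y ((Equiv.refl (Fin 3)) jj) + (0 : UnitAddTorus (Fin 3)) jj) j =
    (mirrorSign i j : ℝ) * tgForce y ((Equiv.refl (Fin 3)) j)
  rw [mirror_affine_eq, Equiv.refl_apply]
  exact tgForce_mirror i y j

/-- The signs of the mirror list are `±1`. [folklore] -/
theorem mirrorList_signs : ∀ p ∈ mirrorList, ∀ j : Fin 3, p.2.1 j = 1 ∨ p.2.1 j = -1 := by
  intro p hp j
  obtain ⟨i, -, rfl⟩ := List.mem_map.1 hp
  exact mirrorSign_eq i j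

/-- **K-symmetric steady states of `NS_ν(f_TG)` at every viscosity** (the common content of the two route
decls): for `ν > 0` there is a steady weak solution `u ∈ V` of `NS_ν(f_TG)` with the energy equality and in
the a.e. mirror class `Fix K`. [cite: Temam1979, Ch. II Thm. 1.2] -/
theorem exists_mirror_steadyWeakSolution_tg {ν : ℝ} (hν : 0 < ν) :
    ∃ u : energySpace (Fin 3), u.1 ∈ energySpaceV (Fin 3) ∧ IsSteadyWeakSolution ν tgForce u ∧
      ν * (eGradNormSq (u.1 : UnitAddTorus (Fin 3) → EuclideanSpace ℝ (Fin 3))).toReal =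
        pairing u.1 tgForce ∧
      ∀ i j : Fin 3,
        (fun x => (u.1 : UnitAddTorus (Fin 3) → EuclideanSpace ℝ (Fin 3)) (Function.update x i (-x i)) j)
          =ᵐ[volume] fun x =>
            if j = i then -((u.1 : UnitAddTorus (Fin 3) → EuclideanSpace ℝ (Fin 3)) x j)
            else (u.1 : UnitAddTorus (Fin 3) → EuclideanSpace ℝ (Fin 3)) x j := by
  obtain ⟨u, hV, hsol, hsym⟩ := exists_symmetric_steadyWeakSolution hν mirrorList mirrorList_signs
    isSmooth_tgForce tgForce_mirrorList
  refine ⟨u, hV, hsol, IsSteadyWeakSolution.energy_eq' (by simp) (isSmooth_tgForce.memLp 2) hV hsol,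
    fun i j => ?_⟩
  have hp : ((Equiv.refl (Fin 3), mirrorSign i, (0 : UnitAddTorus (Fin 3))) :
      Equiv.Perm (Fin 3) × (Fin 3 → ℤ) × UnitAddTorus (Fin 3)) ∈ mirrorList :=
    List.mem_map.2 ⟨i, List.mem_finRange i, rfl⟩
  have key := hsym _ hp j
  refine (Filter.EventuallyEq.of_eq ?_).trans (key.trans (Filter.EventuallyEq.of_eq ?_))
  · funext x
    show (u.1 : UnitAddTorus (Fin 3) → EuclideanSpace ℝ (Fin 3)) (Function.update x i (-x i)) j =
      (u.1 : UnitAddTorus (Fin 3) → EuclideanSpace ℝ (Fin 3))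
        (fun jj => mirrorSign i jj • x ((Equiv.refl (Fin 3)) jj) + (0 : UnitAddTorus (Fin 3)) jj) j
    rw [mirror_affine_eq]
  · funext x
    show (mirrorSign i j : ℝ) * (u.1 : UnitAddTorus (Fin 3) → EuclideanSpace ℝ (Fin 3)) x
        ((Equiv.refl (Fin 3)) j) = _
    rw [Equiv.refl_apply, mirrorSign_mul]

end TaylorGreen

end MirrorSteadyExistence

open Literature.Analysis.FunctionSpaces.Torus Literature.Analysis.FluidPDE.Torus
open Summit.AnomalousDissipation.AnomalousDissipation.Theorems.TaylorGreenLoudGalerkinStates.Negative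
open Summit.AnomalousDissipation.AnomalousDissipation.Theses

/-- **Route decl `SteadyMirrorGate.MirrorSteadyExistenceTG` (stmt-AnomalousDissipation-28078, Ex «MIRROR STEADY
EXISTENCE») holds**: at the pinned Taylor–Green force and every `ν > 0` there is a `K`-symmetric steady weak
solution `u ∈ V` of `NS_ν(f_TG)` with the energy equality (`MirrorSteadyExistence.exists_mirror_steadyWeakSolution_tg`).
[cite: Temam1979, Ch. II Thm. 1.2] -/
theorem steadyMirrorGate_mirrorSteadyExistenceTG_holds : SteadyMirrorGate.MirrorSteadyExistenceTG := by
  intro f hf ν hν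
  subst hf
  exact MirrorSteadyExistence.exists_mirror_steadyWeakSolution_tg hν

/-- **Route decl `PumpSignGate.MirrorSteadyExistenceTG` (the same shared item stmt-AnomalousDissipation-28078)
holds.** [cite: Temam1979, Ch. II Thm. 1.2] -/
theorem pumpSignGate_mirrorSteadyExistenceTG_holds : PumpSignGate.MirrorSteadyExistenceTG := by
  intro f hf ν hν
  subst hf
  exact MirrorSteadyExistence.exists_mirror_steadyWeakSolution_tg hν

end Summit.AnomalousDissipation.AnomalousDissipation.Theorems
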